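/-
Fleet lead `ym-wcr-19609-p1` (seat prover-ym-wcr-19609-p1-g2-0), route `WeakCouplingRates`, crux `BulkDominatesColdBoxW`
(stmt-QuantumFields-19609), line `dlr-chessboard` (v6): the A-cov core with the Gaussian moment hypotheses and the global YM bound DISCHARGED.
-/
import Summits.QuantumFields.YangMills.Theorems.WeakCouplingRatesBulkDominatesColdBoxWKernelCovCore
import Summits.QuantumFields.YangMills.Theorems.WeakCouplingRatesColdBoxDirichletRestrictedCov
import Summits.QuantumFields.YangMills.Theorems.WeakCouplingRatesBulkDominatesColdBoxWDlrPlumbing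

/-!
# Crux `BulkDominatesColdBoxW`, stub `stub_kernelCovExpansion`: A-cov core with moments discharged

`abs_kernelCov_sub_gaussian_le_core₂` (`…KernelCovCore`) takes the Gaussian moment data `K, K'`, `MemLp (Q₁Q₂) 2` and the global bound `|βc| ≤ M₀` as
hypotheses.  Here they are discharged once and for all: `M₀ = 4|β|` (`abs_plaqCostAt_le`), `∫Q_i² ≤ K²` with
`K² = 6Σ_c(F_c⁴ + 3C_pp²) + 6Σ_c(G_c⁴ + 3C_qq²)` (`integral_quadObs_sq_pi_le`), `MemLp (Q₁Q₂) 2` and `∫(Q₁Q₂)² ≤ K'²`,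
`K'² = (216Σ_c(F_c⁸ + 105C_pp⁴) + 216Σ_c(G_c⁸ + 105C_qq⁴))/2` (`integral_quadObs_pow_four_pi_le`, `memLp_two_mul_of_integrable_pow_four`, seat
ym-spine-20043-p1).  What remains abstract in `abs_kernelCov_sub_gaussian_le_moments`: the YM good event `G` with `γ(·|ω)(Gᶜ) ≤ pY`, the chart map / Gaussian
good event / tilt `cfg, S, W` with the three representation identities (T3), the on-`S` bound `M`, the surrogate accuracy `τ` and the tilt bound `w` (T4),
and the Gaussian bad mass `p`.  No new definition; standard axioms.  NOT a claim about the mass gap.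
-/

set_option autoImplicit false

noncomputable section

open MeasureTheory ProbabilityTheory Finset
open Literature.Probability.LatticeModels Literature.MathematicalPhysics.QuantumLattice
open Literature.MathematicalPhysics.QuantumFieldTheory

namespace Summit.QuantumFields.YangMills.Theorems.WeakCouplingRates

/-- **A-cov core, moments discharged.**  See the module docstring; `K`, `K'` are the explicit square roots named there. -/
theorem abs_kernelCov_sub_gaussian_le_moments {H : ℕ} {β : ℝ} (ω : LGConfig 4 (Matrix.specialUnitaryGroup (Fin 2) ℂ))
    (x y : Site 4) (i j k l : Fin 4)
    {G : Set (LGConfig 4 (Matrix.specialUnitaryGroup (Fin 2) ℂ))} (hG : MeasurableSet G) (hG0 : boxKernel β H ω G ≠ 0)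
    {pY : ℝ} (hpY : (boxKernel β H ω).real Gᶜ ≤ pY) {M : ℝ} (hM : 0 ≤ M)
    (cfg : (Fin 3 → EuclideanSpace ℝ (DirFree H)) → LGConfig 4 (Matrix.specialUnitaryGroup (Fin 2) ℂ)) (hcfg : Measurable cfg)
    {S : Set (Fin 3 → EuclideanSpace ℝ (DirFree H))} (hS : MeasurableSet S) (hS0 : (Measure.pi fun _ : Fin 3 => boxDirichlet H) S ≠ 0)
    {p : ℝ} (hp : (Measure.pi fun _ : Fin 3 => boxDirichlet H).real Sᶜ ≤ p)
    {W : (Fin 3 → EuclideanSpace ℝ (DirFree H)) → ℝ} (hWm : Measurable W) {w : ℝ} (hW : ∀ t, |S.indicator W t| ≤ w)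
    (hRepF : ∫ U, β * plaqCostAt (fundamentalRep (Fin 2)) x i j U ∂((boxKernel β H ω)[|G]) =
      ∫ t, β * plaqCostAt (fundamentalRep (Fin 2)) x i j (cfg t)
        ∂(((Measure.pi fun _ : Fin 3 => boxDirichlet H)[|S]).tilted (S.indicator W)))
    (hRepG : ∫ U, β * plaqCostAt (fundamentalRep (Fin 2)) y k l U ∂((boxKernel β H ω)[|G]) =
      ∫ t, β * plaqCostAt (fundamentalRep (Fin 2)) y k l (cfg t)
        ∂(((Measure.pi fun _ : Fin 3 => boxDirichlet H)[|S]).tilted (S.indicator W)))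
    (hRepFG : ∫ U, β * plaqCostAt (fundamentalRep (Fin 2)) x i j U * (β * plaqCostAt (fundamentalRep (Fin 2)) y k l U)
        ∂((boxKernel β H ω)[|G]) =
      ∫ t, β * plaqCostAt (fundamentalRep (Fin 2)) x i j (cfg t) * (β * plaqCostAt (fundamentalRep (Fin 2)) y k l (cfg t))
        ∂(((Measure.pi fun _ : Fin 3 => boxDirichlet H)[|S]).tilted (S.indicator W)))
    (F G' : Fin 3 → ℝ) (p' q' : Plaq 4) {τ : ℝ} (hτ : 0 ≤ τ)
    (hFS : ∀ t ∈ S, 0 ≤ β * plaqCostAt (fundamentalRep (Fin 2)) x i j (cfg t) ∧ β * plaqCostAt (fundamentalRep (Fin 2)) x i j (cfg t) ≤ M)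
    (hGS : ∀ t ∈ S, 0 ≤ β * plaqCostAt (fundamentalRep (Fin 2)) y k l (cfg t) ∧ β * plaqCostAt (fundamentalRep (Fin 2)) y k l (cfg t) ≤ M)
    (hSurF : ∀ t ∈ S, |β * plaqCostAt (fundamentalRep (Fin 2)) x i j (cfg t) - (1 / 2 : ℝ) * ∑ c, (F c + dirCirc H p' (t c)) ^ 2| ≤ τ)
    (hSurG : ∀ t ∈ S, |β * plaqCostAt (fundamentalRep (Fin 2)) y k l (cfg t) - (1 / 2 : ℝ) * ∑ c, (G' c + dirCirc H q' (t c)) ^ 2| ≤ τ) :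
    |β ^ 2 * ((∫ U, plaqCostAt (fundamentalRep (Fin 2)) x i j U * plaqCostAt (fundamentalRep (Fin 2)) y k l U ∂(boxKernel β H ω)) -
          (∫ U, plaqCostAt (fundamentalRep (Fin 2)) x i j U ∂(boxKernel β H ω)) *
            (∫ U, plaqCostAt (fundamentalRep (Fin 2)) y k l U ∂(boxKernel β H ω))) -
        (3 / 2 * boxDirProjKernel H p' q' ^ 2 + (∑ c, F c * G' c) * boxDirProjKernel H p' q')| ≤
      6 * (4 * |β|) * (4 * |β|) * pY +
        (3 * M ^ 2 * (Real.exp (2 * w) - 1) + 6 * M ^ 2 * p +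
          2 * τ * (M + Real.sqrt (6 * ∑ c, (F c ^ 4 + 3 * boxDirProjKernel H p' p' ^ 2) +
            6 * ∑ c, (G' c ^ 4 + 3 * boxDirProjKernel H q' q' ^ 2))) +
          Real.sqrt p * (2 * M * Real.sqrt (6 * ∑ c, (F c ^ 4 + 3 * boxDirProjKernel H p' p' ^ 2) +
              6 * ∑ c, (G' c ^ 4 + 3 * boxDirProjKernel H q' q' ^ 2)) +
            Real.sqrt ((216 * ∑ c, (F c ^ 8 + 105 * boxDirProjKernel H p' p' ^ 4) +
              216 * ∑ c, (G' c ^ 8 + 105 * boxDirProjKernel H q' q' ^ 4)) / 2) +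
            (6 * ∑ c, (F c ^ 4 + 3 * boxDirProjKernel H p' p' ^ 2) + 6 * ∑ c, (G' c ^ 4 + 3 * boxDirProjKernel H q' q' ^ 2)))) := by
  -- the global YM bound
  have hfM : ∀ U, |β * plaqCostAt (fundamentalRep (Fin 2)) x i j U| ≤ 4 * |β| := fun U => by
    rw [abs_mul]; nlinarith [abs_plaqCostAt_le x i j U, abs_nonneg β, abs_nonneg (plaqCostAt (fundamentalRep (Fin 2)) x i j U)]
  have hgM : ∀ U, |β * plaqCostAt (fundamentalRep (Fin 2)) y k l U| ≤ 4 * |β| := fun U => by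
    rw [abs_mul]; nlinarith [abs_plaqCostAt_le y k l U, abs_nonneg β, abs_nonneg (plaqCostAt (fundamentalRep (Fin 2)) y k l U)]
  -- nonnegativity of the moment constants
  have h4e : Even 4 := by decide
  have h8e : Even 8 := by decide
  have hA0 : 0 ≤ 6 * ∑ c, (F c ^ 4 + 3 * boxDirProjKernel H p' p' ^ 2) :=
    mul_nonneg (by norm_num) (Finset.sum_nonneg fun c _ =>
      add_nonneg (h4e.pow_nonneg _) (mul_nonneg (by norm_num) (sq_nonneg _)))
  have hB0 : 0 ≤ 6 * ∑ c, (G' c ^ 4 + 3 * boxDirProjKernel H q' q' ^ 2) :=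
    mul_nonneg (by norm_num) (Finset.sum_nonneg fun c _ =>
      add_nonneg (h4e.pow_nonneg _) (mul_nonneg (by norm_num) (sq_nonneg _)))
  have hAB0 : 0 ≤ 6 * ∑ c, (F c ^ 4 + 3 * boxDirProjKernel H p' p' ^ 2) + 6 * ∑ c, (G' c ^ 4 + 3 * boxDirProjKernel H q' q' ^ 2) := by
    linarith
  have hA'0 : 0 ≤ 216 * ∑ c, (F c ^ 8 + 105 * boxDirProjKernel H p' p' ^ 4) :=
    mul_nonneg (by norm_num) (Finset.sum_nonneg fun c _ =>
      add_nonneg (h8e.pow_nonneg _) (mul_nonneg (by norm_num) (h4e.pow_nonneg _)))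
  have hB'0 : 0 ≤ 216 * ∑ c, (G' c ^ 8 + 105 * boxDirProjKernel H q' q' ^ 4) :=
    mul_nonneg (by norm_num) (Finset.sum_nonneg fun c _ =>
      add_nonneg (h8e.pow_nonneg _) (mul_nonneg (by norm_num) (h4e.pow_nonneg _)))
  have hAB'0 : 0 ≤ (216 * ∑ c, (F c ^ 8 + 105 * boxDirProjKernel H p' p' ^ 4) +
      216 * ∑ c, (G' c ^ 8 + 105 * boxDirProjKernel H q' q' ^ 4)) / 2 := by linarith
  -- second moments
  have hK₁ : ∫ t, ((1 / 2 : ℝ) * ∑ c, (F c + dirCirc H p' (t c)) ^ 2) ^ 2 ∂(Measure.pi fun _ : Fin 3 => boxDirichlet H) ≤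
      Real.sqrt (6 * ∑ c, (F c ^ 4 + 3 * boxDirProjKernel H p' p' ^ 2) + 6 * ∑ c, (G' c ^ 4 + 3 * boxDirProjKernel H q' q' ^ 2)) ^ 2 := by
    rw [Real.sq_sqrt hAB0]; exact (integral_quadObs_sq_pi_le (H := H) F p').trans (by linarith)
  have hK₂ : ∫ t, ((1 / 2 : ℝ) * ∑ c, (G' c + dirCirc H q' (t c)) ^ 2) ^ 2 ∂(Measure.pi fun _ : Fin 3 => boxDirichlet H) ≤
      Real.sqrt (6 * ∑ c, (F c ^ 4 + 3 * boxDirProjKernel H p' p' ^ 2) + 6 * ∑ c, (G' c ^ 4 + 3 * boxDirProjKernel H q' q' ^ 2)) ^ 2 := by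
    rw [Real.sq_sqrt hAB0]; exact (integral_quadObs_sq_pi_le (H := H) G' q').trans (by linarith)
  -- fourth moments ⇒ the product is in L² with controlled second moment
  obtain ⟨hI₁, h4₁⟩ := integral_quadObs_pow_four_pi_le (H := H) F p'
  obtain ⟨hI₂, h4₂⟩ := integral_quadObs_pow_four_pi_le (H := H) G' q'
  have hm₁ : AEStronglyMeasurable (fun t : Fin 3 → EuclideanSpace ℝ (DirFree H) => (1 / 2 : ℝ) * ∑ c, (F c + dirCirc H p' (t c)) ^ 2)
      (Measure.pi fun _ : Fin 3 => boxDirichlet H) := (memLp_two_quadObs_pi (H := H) F p').aestronglyMeasurable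
  have hm₂ : AEStronglyMeasurable (fun t : Fin 3 → EuclideanSpace ℝ (DirFree H) => (1 / 2 : ℝ) * ∑ c, (G' c + dirCirc H q' (t c)) ^ 2)
      (Measure.pi fun _ : Fin 3 => boxDirichlet H) := (memLp_two_quadObs_pi (H := H) G' q').aestronglyMeasurable
  obtain ⟨hQ₁₂, hprod⟩ := memLp_two_mul_of_integrable_pow_four (μ := Measure.pi fun _ : Fin 3 => boxDirichlet H) hm₁ hm₂ hI₁ hI₂
  have hK₁₂ : ∫ t, (((1 / 2 : ℝ) * ∑ c, (F c + dirCirc H p' (t c)) ^ 2) * ((1 / 2 : ℝ) * ∑ c, (G' c + dirCirc H q' (t c)) ^ 2)) ^ 2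
        ∂(Measure.pi fun _ : Fin 3 => boxDirichlet H) ≤
      Real.sqrt ((216 * ∑ c, (F c ^ 8 + 105 * boxDirProjKernel H p' p' ^ 4) +
        216 * ∑ c, (G' c ^ 8 + 105 * boxDirProjKernel H q' q' ^ 4)) / 2) ^ 2 := by
    rw [Real.sq_sqrt hAB'0]
    refine hprod.trans ?_
    have hsum := add_le_add h4₁ h4₂
    linarith
  have h := abs_kernelCov_sub_gaussian_le_core₂ ω x y i j k l hG hG0 hpY hM hfM hgM cfg hcfg hS hS0 hp hWm hW hRepF hRepG hRepFG
    F G' p' q' hτ (Real.sqrt_nonneg _) (Real.sqrt_nonneg _) hFS hGS hSurF hSurG hQ₁₂ hK₁ hK₂ hK₁₂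
  rw [Real.sq_sqrt hAB0] at h
  exact h

end Summit.QuantumFields.YangMills.Theorems.WeakCouplingRates

end
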